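/- Copyright: the b2b-balaban cell (near-miss cell 7), T⁴-continuum fan-out, lineage t4-ne7b-formalise-leaf-06 (NE7b CRUX
TEAM (2) leaf prover 06), gen 32: «THE ROUNDING WINDOW», file 4 — the instantiation of record R-OWNER-47-1 (a).
Released under the licence of the surrounding project. -/
import Summits.QuantumFields.BalabanUV.T4Continuum.Support.HistoryBankingRoundingSupply

/-!
# History banking, M5-3 (γ′) file 4: THE RENEWAL EXPONENT UNROUNDED — `RoundingRoomF` at the instantiation of record
`sR := S_h` (R-OWNER-47-1 (a), adopting refuter PRICING-NE7b v13 L-v13-1 ∕ F73 (v); owner word (e) → leaf-06; F78 ∕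
L-v14-1 «take `t := d + 3`» concurred by the owner g47)

Summits-side support leaf of the T⁴-continuum cell (rung (B)+1 on a FINITE torus only; NOT infinite volume, NOT the
mass gap, NOT the Clay statement; NOT a proof of the spine estimate NE7b — the cell's OWN estimate, NOT PRINTED, NOT
PROVED).  [folklore] real arithmetic over the siblings `HistoryBankingSharpShares` (`ell`, `sRsharp`, `sBsharp`),
`HistoryBankingRoundingWindow` (`SharpWindow`), `HistoryBankingRoundingSupply` (`roundingRoomF_of_dominating`,
`sharpWindow_of_couplings`, `envelope_of_isRj`) and the OWNER's `HistoryBankingFibreRoom.RoundingRoomF`; the printed LOCUS is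
the LEFT exponent of `B16Sect1Kernels.lfFactor178` ([B16] p. 383 after (1.78)) — a LOCATOR, nothing of it asserted; no
`[cite:]` tag, no `def … : Prop`, zero `sorry`.

WHY.  RULING R-OWNER-47-1 (a) (journal l.31984) fixes the instantiation of record of the renewal sharp letter as the
UNROUNDED (1.77)–(1.78) exponent `S_h = ½γ₀·W_h⁻¹·A₁²·p₁(g_h)²`, `W_h = 6(d+3)(100M(L+1)N_h^{β₀}R_h)^{d+2}`, `N_h := R_h`,
with the amplitude-free profile `p₁(g) = (log g⁻²)^{p₁}` — so that `FactorRead.fR_le` IS print's p. 383 sentence read on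
VALUES and the renewal clause is the refuter's ONE decidable clause (F″) — and asks (e) «→ leaf-06: instantiate
`roundingRoomF_sharp` at `sR := S_h`, Â₀ = 1, `sB` as in (a)»; F78 ∕ L-v14-1 (refuter v14, owner concur l.32228): «take the
size power `t := d + 3` (print's `(d+2)(1+β₀) ≤ d + 3`), NOT `d + 5`, and book `Ap₁`'s consistency constraint with
`FactorRead` at `sR := S_h`».  THIS FILE does exactly that, ON THE NOSE: `S_h` dominates the sibling's letter
`sRsharp (d+3) Ap₁♭ p₁ R g` with the FOLDED amplitude `Ap₁♭² = ½γ₀A₁²∕(6(d+3)(100M(L+1))^{d+2})` (= `γ₀A₁²∕T(m′)` in the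
refuter's letters, `T(m′) = 84·(1400·13^{m′})⁶` at `d = 4`, `L = 13`, `M = 13^{m′}`) as soon as `β₀(d+2) ≤ 1` and `R_h ≥ 1` — so `roundingRoomF_of_dominating` applies with the window at `t = d + 3`; any birth letter `≥ sBsharp O m C g`
(e.g. (a)'s full p. 381 exponent carrying `+ 2p₀`) rides along.  The consistency constraint F78 names
(`Ap₁² ≤ γ₀A₁²R_h^{t−48∕7}∕T(m′)`) is MET BY CONSTRUCTION: `Ap₁♭² = γ₀A₁²∕T(m′)` and `R_h^{t−(1+β₀)(d+2)} ≥ 1`.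

WHAT.  §1 **`Wunr M Lr β₀ d R h`** `= 6(d+3)(100·M·(Lr+1)·R_h^{β₀}·R_h)^{d+2}` (print's `W_h` at `N_h := R_h`, real power),
**`sRunr γ₀ A₁ M Lr β₀ d p₁ R g h`** `= ½γ₀·(Wunr …)⁻¹·A₁²·(ℓ_h^{p₁})²` — LITERALLY the left exponent of `lfFactor178 γ₀ W A₁
(p₁g²) p₁g R_h d` at `p₁g = ℓ_h^{p₁}` (`neg_sRunr_eq_lfFactor_left`); the folded amplitude **`ApFlat γ₀ A₁ M Lr d`**
`= √(½γ₀A₁²∕(6(d+3)(100M(Lr+1))^{d+2}))`.  §2 **`sRsharp_le_sRunr`**: `sRsharp (d+3) (ApFlat …) p₁ R g h ≤ sRunr … h` for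
`β₀·(d+2) ≤ 1`, `1 ≤ R_h`, `0 ≤ γ₀`, `0 < M`, `0 ≤ Lr` (one `Real.rpow` step: `R^{β₀(d+2)} ≤ R`).  §3
**`roundingRoomF_unrounded`**: `RoundingRoomF C O L K R g sB (sRunr O.γ₀ O.A₁ O.M Lr O.β₀ O.d p₁ R g) φB φR` for ANY
birth letter `sB ≥ sBsharp O m C g`, under the siblings' hypotheses with the window `SharpWindow C O L K r p₁ (O.d+3) η η′ κ
(ApFlat O.γ₀ O.A₁ O.M Lr O.d) Φ g`, `1 ≤ R_h` for all `h` (the witness's `one_le_R`) and `β₀(d+2) ≤ 1`;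
**`roundingRoomF_unrounded_of_couplings`** (from `0 < g_j ≤ γ ≤ e^{−ℓ⋆∕2}`, (2.9), (2.5)).  §4 the (F″) CORRESPONDENCE
(docstring, no new mathematics): at `t = d+3` the window's renewal clauses read (WR1) `2·Â₀·L^{d+3} ≤ Ap₁♭²·ℓ^{η}`,
`η = 2p₁ − p₀ − r(d+3)` (= 5 at the census letters) and (WR2) `48(1+Φ)L^{3(q′+1)}L^{d+3} ≤ Ap₁♭²·ℓ^{η′}` — the refuter's
(F″) `γ₀A₁²ℓ^{37∕7} ≥ c^{48∕7}T(m′)(1 + S_b∕ℓ²³)` is the same inequality with the L-adic size `R = cℓ²` kept exact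
(`c ∈ [1, 13)`, exponent `(1+β₀)(d+2) = 48∕7`) where this file uses the uniform envelopes `R ≤ L·ℓ^{r}`,
`R^{(1+β₀)(d+2)} ≤ R^{d+3}`; the census price is the refuter's ((WR1)@t=7 binds from m′ = 2; class K°; NE7b-ROUND-1).

HONEST SCOPE.  Real arithmetic over OUR carriers; `SharpWindow`, the φ-budgets and `FactorRead` (at `S_h`: print's p. 383
sentence read on M2-B's factor VALUES) stay HYPOTHESIS SHAPES; nothing of H3 ∕ (B) ∕ BetaPertH discharged; nothing of
Bałaban's asserted or contested.  NE7b NOT PRINTED ∕ NOT PROVED; spine 0∕9; rung (B)+1 on a FINITE torus — NOT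
infinite volume, NOT the mass gap, NOT Clay.  HONEST DEPENDENCY (cell): continuum YM on T⁴ ⇐ BetaPertH ∧ nine spine
estimates (0/9 proved); BetaPertH ⇐ (D1) ∧ (D4) ∧ CAP+tail; G-an2-4 gates asym, D1 and NE2/3/4.  This file changes none
of it.
-/

open Finset
open Literature.MathematicalPhysics.QuantumFieldTheory.Balaban1983to89
open T4PersistenceDictionary T4PrintedShapeBanking
open Summit.QuantumFields.BalabanUV.T4Continuum.HistoryConstants
open Summit.QuantumFields.BalabanUV.T4Continuum.HistoryBankingDiscountCharge
open Summit.QuantumFields.BalabanUV.T4Continuum.HistoryBankingFibreRoom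
open Summit.QuantumFields.BalabanUV.T4Continuum.HistoryBankingSharpShares
open Summit.QuantumFields.BalabanUV.T4Continuum.HistoryBankingRoundingWindow
open Summit.QuantumFields.BalabanUV.T4Continuum.HistoryBankingRoundingSupply

namespace Summit.QuantumFields.BalabanUV.T4Continuum.HistoryBankingRoundingUnrounded

noncomputable section

/-! ## §1 Print's unrounded renewal exponent `S_h` and the folded amplitude -/

section Letters

/-- **PRINT'S `W_h` AT `N_h := R_h`**: `Wunr M Lr β₀ d R h = 6(d+3)·(100·M·(Lr+1)·R_h^{β₀}·R_h)^{d+2}` — the bracket of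
(1.78) p. 383 (`B16Sect1Kernels.Ineq178`∕`lfFactor178`'s `W`), `N^{β₀}` read at `N := R_h` (p. 384 «with N = R_j»;
R-OWNER-47-1 (a)); `β₀` a real exponent (`Real.rpow`). [folklore] -/
def Wunr (M Lr β₀ : ℝ) (d : ℕ) (R : ℕ → ℕ) (h : ℕ) : ℝ :=
  6 * ((d : ℝ) + 3) * (100 * M * (Lr + 1) * (R h : ℝ) ^ β₀ * (R h : ℝ)) ^ (d + 2)

/-- **PRINT'S UNROUNDED RENEWAL EXPONENT `S_h`** (the instantiation of record R-OWNER-47-1 (a)):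
`sRunr γ₀ A₁ M Lr β₀ d p₁ R g h = ½γ₀·(W_h)⁻¹·A₁²·(ℓ_h^{p₁})²` with the amplitude-free profile `p₁(g) = ℓ^{p₁}` — the LEFT
exponent of the large-field-factor sentence of [B16] p. 383 after (1.78) (`B16Sect1Kernels.lfFactor178`, a LOCATOR).
[folklore] -/
def sRunr (γ₀ A₁ M Lr β₀ : ℝ) (d p₁ : ℕ) (R : ℕ → ℕ) (g : ℕ → ℝ) (h : ℕ) : ℝ :=
  1 / 2 * γ₀ * (Wunr M Lr β₀ d R h)⁻¹ * A₁ ^ 2 * (ell g h ^ p₁) ^ 2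

/-- the letter, negated, IS `lfFactor178 γ₀ W_h A₁ (p₁g²) p₁g R_h d`'s left exponent at `p₁g = ℓ_h^{p₁}` (the corrected
reading `p₁g′ = p₁g²` of the slip note D-b02.7) — syntactic bridge. [folklore] -/
theorem neg_sRunr_eq_lfFactor_left (γ₀ A₁ M Lr β₀ : ℝ) (d p₁ : ℕ) (R : ℕ → ℕ) (g : ℕ → ℝ) (h : ℕ) :
    -sRunr γ₀ A₁ M Lr β₀ d p₁ R g h =
      -(1 / 2) * γ₀ * (Wunr M Lr β₀ d R h)⁻¹ * A₁ ^ 2 * (ell g h ^ p₁) ^ 2 := by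
  unfold sRunr; ring

/-- **THE FOLDED AMPLITUDE** `Ap₁♭ = √(½γ₀A₁²∕(6(d+3)(100M(Lr+1))^{d+2}))` (`= √(γ₀A₁²∕T(m′))` in the refuter's letters):
the constant part of `S_h` read as the amplitude of the sibling's letter `sRsharp (d+3) Ap₁♭ p₁`. [folklore] -/
def ApFlat (γ₀ A₁ M Lr : ℝ) (d : ℕ) : ℝ :=
  Real.sqrt (1 / 2 * γ₀ * A₁ ^ 2 / (6 * ((d : ℝ) + 3) * (100 * M * (Lr + 1)) ^ (d + 2)))

variable {γ₀ A₁ M Lr β₀ : ℝ} {d : ℕ}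

/-- the folded amplitude squared (nonnegative radicand: `γ₀ ≥ 0`, `M > 0`, `Lr ≥ 0`). [folklore] -/
theorem ApFlat_sq (hγ₀ : 0 ≤ γ₀) (hM : 0 < M) (hLr : 0 ≤ Lr) :
    ApFlat γ₀ A₁ M Lr d ^ 2 = 1 / 2 * γ₀ * A₁ ^ 2 / (6 * ((d : ℝ) + 3) * (100 * M * (Lr + 1)) ^ (d + 2)) := by
  unfold ApFlat
  rw [Real.sq_sqrt]
  positivity

end Letters

/-! ## §2 `S_h` dominates the sibling's letter at the size power `d + 3` -/

section Dominate

variable {γ₀ A₁ M Lr β₀ : ℝ} {d p₁ : ℕ} {R : ℕ → ℕ} {g : ℕ → ℝ}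

/-- the real-power step: `(R^{β₀}·R)^{d+2} ≤ R^{d+3}` for `R ≥ 1` and `β₀(d+2) ≤ 1` (any real `β₀`). [folklore] -/
theorem rpow_bracket_le {x : ℝ} (hx : 1 ≤ x) (hβd : β₀ * ((d : ℝ) + 2) ≤ 1) :
    (x ^ β₀ * x) ^ (d + 2) ≤ x ^ (d + 3) := by
  have hx0 : 0 < x := by linarith
  have h1 : (x ^ β₀ * x) ^ (d + 2) = x ^ (β₀ * ((d : ℝ) + 2)) * x ^ (d + 2) := by
    rw [mul_pow, ← Real.rpow_natCast (x ^ β₀) (d + 2), ← Real.rpow_mul hx0.le]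
    push_cast
    ring
  have h2 : x ^ (β₀ * ((d : ℝ) + 2)) ≤ x ^ (1 : ℝ) := Real.rpow_le_rpow_of_exponent_le hx hβd
  rw [Real.rpow_one] at h2
  have h3 : 0 ≤ x ^ (d + 2) := by positivity
  calc (x ^ β₀ * x) ^ (d + 2) = x ^ (β₀ * ((d : ℝ) + 2)) * x ^ (d + 2) := h1
    _ ≤ x * x ^ (d + 2) := mul_le_mul_of_nonneg_right h2 h3
    _ = x ^ (d + 3) := by ring

/-- **`S_h` DOMINATES THE SIBLING's LETTER AT `t = d + 3` WITH THE FOLDED AMPLITUDE**: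
`sRsharp (d+3) (ApFlat γ₀ A₁ M Lr d) p₁ R g h ≤ sRunr γ₀ A₁ M Lr β₀ d p₁ R g h` for `0 ≤ γ₀`, `0 < M`, `0 ≤ Lr`,
`β₀(d+2) ≤ 1`, `1 ≤ R_h` (print's `(d+2)(1+β₀) ≤ d+3`, F78). [folklore] -/
theorem sRsharp_le_sRunr (hγ₀ : 0 ≤ γ₀) (hM : 0 < M) (hLr : 0 ≤ Lr) (hβd : β₀ * ((d : ℝ) + 2) ≤ 1)
    {h : ℕ} (hR : 1 ≤ R h) :
    sRsharp (d + 3) (ApFlat γ₀ A₁ M Lr d) p₁ R g h ≤ sRunr γ₀ A₁ M Lr β₀ d p₁ R g h := by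
  have hR' : (1 : ℝ) ≤ R h := by exact_mod_cast hR
  have hR0 : (0 : ℝ) < R h := by linarith
  set B : ℝ := 6 * ((d : ℝ) + 3) * (100 * M * (Lr + 1)) ^ (d + 2) with hB
  have hB0 : 0 < B := by rw [hB]; positivity
  have hW : Wunr M Lr β₀ d R h = B * ((R h : ℝ) ^ β₀ * R h) ^ (d + 2) := by
    unfold Wunr
    rw [hB, show 100 * M * (Lr + 1) * (R h : ℝ) ^ β₀ * (R h : ℝ) = (100 * M * (Lr + 1)) * ((R h : ℝ) ^ β₀ * R h) by
      ring, mul_pow]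
    ring
  have hbr := rpow_bracket_le (d := d) hR' hβd
  have hbr0 : 0 < ((R h : ℝ) ^ β₀ * R h) ^ (d + 2) := by positivity
  have hW0 : 0 < Wunr M Lr β₀ d R h := by rw [hW]; positivity
  -- both sides as `c · ℓ^{2p₁} / (size power)`
  have hℓ : 0 ≤ (ell g h ^ p₁) ^ 2 := sq_nonneg _
  unfold sRsharp sRunr
  rw [mul_pow, ApFlat_sq hγ₀ hM hLr, ← hB]
  -- LHS = (R^{d+3})⁻¹ * (½γ₀A₁²/B) * ℓ² ; RHS = ½γ₀ W⁻¹ A₁² ℓ²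
  have key : ((R h : ℝ) ^ (d + 3))⁻¹ ≤ (((R h : ℝ) ^ β₀ * R h) ^ (d + 2))⁻¹ :=
    inv_anti₀ hbr0 hbr
  have hc : 0 ≤ 1 / 2 * γ₀ * A₁ ^ 2 / B * (ell g h ^ p₁) ^ 2 := by positivity
  calc ((R h : ℝ) ^ (d + 3))⁻¹ * (1 / 2 * γ₀ * A₁ ^ 2 / B * (ell g h ^ p₁) ^ 2)
      ≤ (((R h : ℝ) ^ β₀ * R h) ^ (d + 2))⁻¹ * (1 / 2 * γ₀ * A₁ ^ 2 / B * (ell g h ^ p₁) ^ 2) :=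
        mul_le_mul_of_nonneg_right key hc
    _ = 1 / 2 * γ₀ * (Wunr M Lr β₀ d R h)⁻¹ * A₁ ^ 2 * (ell g h ^ p₁) ^ 2 := by
        rw [hW, mul_inv]
        field_simp

end Dominate

/-! ## §3 `RoundingRoomF` at the instantiation of record -/

section Record

variable {C : T4PrintedShapeBanking.Consts} {O : PrintedO1s} {L K r p₁ η η' κ : ℕ} {Φ m Lr : ℝ} {R : ℕ → ℕ}
  {g : ℕ → ℝ} {β' β₀ : ℝ} {φB : ℕ → ℕ → ℝ} {φR : ℕ → ℝ} {sB : ℕ → ℕ → ℝ}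

/-- **`RoundingRoomF` AT `sR := S_h` (R-OWNER-47-1 (a)) AND ANY BIRTH LETTER `sB ≥ sBsharp O m C g`**: under (2.9), the
(2.5) envelope, `1 ≤ R_h` for ALL `h`, `0 < E₂`, `0 ≤ E₃`, `1 ≤ L`, `0 ≤ γ₀`, `0 < M`, `0 ≤ Lr`,
`β₀(d+2) ≤ 1`, `0 ≤ A₀`, `0 ≤ Φ`, `A₁² ≤ m`, the window `SharpWindow C O L K r p₁ (O.d+3) η η′ κ (ApFlat O.γ₀ O.A₁ O.M Lr
O.d) Φ g` and the φ-budgets.  (`Lr` is the real reading of print's block letter `L` inside `W_h`; at the plug `Lr := L`.)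
[folklore] -/
theorem roundingRoomF_unrounded (hE₂ : 0 < C.E₂) (hE₃ : 0 ≤ C.E₃) (hL : 1 ≤ L) (hγ₀ : 0 ≤ O.γ₀) (hM : 0 < O.M)
    (hLr : 0 ≤ Lr) (hβd : O.β₀ * ((O.d : ℝ) + 2) ≤ 1) (hA₀ : 0 ≤ C.A₀) (hΦ : 0 ≤ Φ)
    (hm : O.A₁ ^ 2 ≤ m) (h29 : B14FlowStep.FlowIneq29 R g L β' β₀ K)
    (hRup : ∀ j, j ≤ K → (R j : ℝ) ≤ L * ell g j ^ r) (hR1 : ∀ h, 1 ≤ R h)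
    (hW : SharpWindow C O L K r p₁ (O.d + 3) η η' κ (ApFlat O.γ₀ O.A₁ O.M Lr O.d) Φ g)
    (hφB : ∀ j d', φB j d' ≤ Φ * dshare C L R ((j, 0, d') : PEv))
    (hφR : ∀ h, φR h ≤ Φ * dshare C L R ((h + 1, 1, 0) : PEv)) (hsB : ∀ j d', sBsharp O m C g j d' ≤ sB j d') :
    RoundingRoomF C O L K R g sB (sRunr O.γ₀ O.A₁ O.M Lr O.β₀ O.d p₁ R g) φB φR :=
  roundingRoomF_of_dominating hE₂ hE₃ hL hγ₀ hA₀ hΦ hm h29 hRup (fun j _ => hR1 j) hW hφB hφR hsB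
    fun h => sRsharp_le_sRunr hγ₀ hM hLr hβd (hR1 h)

/-- **… FROM THE COUPLINGS AND (2.5)** (the END-facing one-call form at the instantiation of record): exponent bookkeeping
at `t = d + 3`, gaps `≥ 1`, `p₀ ≥ 1`, `ApFlat … ≠ 0`, `γ₀ > 0`, `A₁ ≠ 0`, `A₀ > 0`, `M > 0`, `Lr ≥ 0`,
`β₀(d+2) ≤ 1`, `Φ ≥ 0`, `E₂ > 0`, `E₃ ≥ 0`, `L ≥ 1`, `A₁² ≤ m`, (2.9), (2.5) `B14.IsRj` (`j ≤ K`), `1 ≤ R_h` (all `h`),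
every coupling `0 < g_j ≤ γ ≤ e^{−ℓ⋆∕2}` (`j ≤ K`), the φ-budgets, `sB ≥ sBsharp O m C g`. [folklore] -/
theorem roundingRoomF_unrounded_of_couplings {γ : ℝ} (hexpR : C.p₀ + r * (O.d + 3) + η = 2 * p₁)
    (hexpR' : r * (C.q' + 1) + r * (O.d + 3) + η' = 2 * p₁) (hexpB : r * (C.q' + 1) + κ = 2 * C.p₀)
    (hη : 1 ≤ η) (hη' : 1 ≤ η') (hκ : 1 ≤ κ) (hp₀ : 1 ≤ C.p₀) (hAp : ApFlat O.γ₀ O.A₁ O.M Lr O.d ≠ 0)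
    (hγ₀ : 0 < O.γ₀) (hA₁ : O.A₁ ≠ 0) (hA₀ : 0 < C.A₀) (hM : 0 < O.M) (hLr : 0 ≤ Lr)
    (hβd : O.β₀ * ((O.d : ℝ) + 2) ≤ 1) (hΦ : 0 ≤ Φ) (hE₂ : 0 < C.E₂) (hE₃ : 0 ≤ C.E₃) (hL : 1 ≤ L)
    (hm : O.A₁ ^ 2 ≤ m) (h29 : B14FlowStep.FlowIneq29 R g L β' β₀ K)
    (hRj : ∀ j, j ≤ K → B14.IsRj L r (g j) (R j)) (hR1 : ∀ h, 1 ≤ R h)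
    (hγ : γ ≤ Real.exp (-(ellStar C O L (O.d + 3) η η' κ (ApFlat O.γ₀ O.A₁ O.M Lr O.d) Φ / 2)))
    (hg : ∀ j, j ≤ K → 0 < g j ∧ g j ≤ γ)
    (hφB : ∀ j d', φB j d' ≤ Φ * dshare C L R ((j, 0, d') : PEv))
    (hφR : ∀ h, φR h ≤ Φ * dshare C L R ((h + 1, 1, 0) : PEv)) (hsB : ∀ j d', sBsharp O m C g j d' ≤ sB j d') :
    RoundingRoomF C O L K R g sB (sRunr O.γ₀ O.A₁ O.M Lr O.β₀ O.d p₁ R g) φB φR :=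
  have hW := sharpWindow_of_couplings hexpR hexpR' hexpB hη hη' hκ hp₀ hAp hγ₀ hA₁ hA₀ hΦ hE₂ hE₃ hγ hg
  roundingRoomF_unrounded hE₂ hE₃ hL hγ₀.le hM hLr hβd hA₀.le hΦ hm h29
    (fun j hj => (envelope_of_isRj hL (hRj j hj) (hW.one_le_ell j hj)).1) hR1 hW hφB hφR hsB

end Record

end

end Summit.QuantumFields.BalabanUV.T4Continuum.HistoryBankingRoundingUnrounded
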